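import Summits.ResolutionOfSingularities.ResolutionOfSingularities.Theorems.PAlterationPialtFrobeniusSandwich
import Literature.AlgebraicGeometry.Resolution.ZariskiPatchingProperModels
import Literature.AlgebraicGeometry.Resolution.ValuedFunctionFieldsLemmas
import Literature.AlgebraicGeometry.Resolution.CompleteLocalDomainJ0Lemmas
import Literature.AlgebraicGeometry.Resolution.ProjectiveSpaceRegular
import Literature.AlgebraicGeometry.Resolution.FieldsJ2
import HarnessLib

/-!
# `Pialt` (crux stmt-ResolutionOfSingularities-0555), line `SketchIdeator2` / Card A: tame local uniformization on `K` itself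

Helper file for the OPEN stub `stub_tameResolution` (`TameResolution_p`) of the lead's skeleton
`radicially-regular-endgame` (`--supports stmt-ResolutionOfSingularities-0555`; it does not close
the item). Steps V1, V3, V4 of `Cruxes/Pialt/STUB-PLAN-stub_tameResolution.md`.

An affine `k`-scheme `Spec T` is **radicially regular (RR)** if an integral regular scheme maps
onto it by a finite, universally injective, surjective morphism (inlined in the statements).

* `exists_not_mem_forall_mem_regularLocus` (V1) — for a finitely generated algebra `T` over a
  field and a prime `𝔭` in the regular locus, some basic open `D(g) ∋ 𝔭` lies in the regular
  locus (fields are J-2, `isJ2Ring_of_field`).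
* `exists_rrModel_le_of_temkin2013` (V3) — **Temkin's inseparable local uniformization gives
  TAME local uniformization on `K` itself, WITHOUT extending the function field**: under the
  named fact `Temkin2013` (Temkin 2013, Thm. 1.3.2, weak form), for every finitely generated
  `K/k` of characteristic `p` and every valuation ring `O ∋ k` of `K` there is a finitely
  generated `k`-subalgebra `T ⊆ O` with `Frac T = K` and `Spec T` radicially regular. Proof:
  Temkin gives a finite purely inseparable `L/K`, the valuation ring `O'` of `L` over `O` and a
  finitely generated `A ⊆ O'`, `Frac A = L`, regular at the centre `𝔪_{O'} ∩ A`; by V1 some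
  `g ∈ A` off the centre has `D(g) ⊆ Reg A`, so `B := A[1/g] ⊆ O'` (as `g` is a unit of `O'`)
  is a finitely generated REGULAR affine model of `L`; the Frobenius sandwich
  (`PAlterationPialtFrobeniusSandwich.lean`) makes `T := B ∩ K ⊆ O' ∩ K = O` finitely
  generated with `Frac T = K` and `Spec B → Spec T` finite radicial surjective.
* `exists_finite_rrSystem` (V4) — **a finite RR affine system by Zariski compactness**: if every
  valuation ring of `K/k` contains a finitely generated RR affine model of `K`, finitely many
  such models suffice for all valuations (the domination loci `{w : T ⊆ 𝒪_w}` are open,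
  `ZariskiRiemannSpace.isOpen_setOf_le`, and `Zar(K/k)` is quasi-compact). Unlike Zariski's
  finiteness theorem no openness of a regular locus is needed: `Spec T` is RR globally.
-/

set_option linter.dupNamespace false -- mandated namespace of this single-conjunct summit

noncomputable section

open CategoryTheory AlgebraicGeometry IsLocalRing
open Literature.AlgebraicGeometry.Resolution

namespace Summit.ResolutionOfSingularities.ResolutionOfSingularities.Theorems.Pialt.RadiciallyRegular

/-! ## A regular prime has a regular basic open neighbourhood (V1) -/

/-- **A regular point of a variety has a regular affine neighbourhood `D(g)`**: for a finitely
generated algebra `T` over a field `k` and `𝔭 ∈ Reg(T)`, there is `g ∉ 𝔭` with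
`D(g) ⊆ Reg(T)` — the regular locus is open since fields are J-2 (`isJ2Ring_of_field`), and the
basic opens form a basis. [cite: Matsumura1987, §30, Cor. to Thm. 30.5] -/
theorem exists_not_mem_forall_mem_regularLocus (k : Type) [Field k] (T : Type) [CommRing T]
    [Algebra k T] [Algebra.FiniteType k T] (𝔭 : PrimeSpectrum T) (h𝔭 : 𝔭 ∈ regularLocus T) :
    ∃ g : T, g ∉ 𝔭.asIdeal ∧ ∀ 𝔮 : PrimeSpectrum T, g ∉ 𝔮.asIdeal → 𝔮 ∈ regularLocus T := by
  have hreg : IsOpen (regularLocus T) := (isJ2Ring_of_field k).2 T ‹_›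
  obtain ⟨_, ⟨g, rfl⟩, hgp, hgreg⟩ :=
    PrimeSpectrum.isTopologicalBasis_basic_opens.mem_nhds_iff.mp (hreg.mem_nhds h𝔭)
  refine ⟨g, ?_, fun 𝔮 h𝔮 => hgreg ?_⟩
  · have h1 : 𝔭 ∈ PrimeSpectrum.basicOpen g := hgp
    rwa [PrimeSpectrum.mem_basicOpen] at h1
  · change 𝔮 ∈ PrimeSpectrum.basicOpen g
    rwa [PrimeSpectrum.mem_basicOpen]

/-! ## Tame local uniformization on `K` itself (V3) -/

/-- **Temkin's inseparable local uniformization gives tame local uniformization on `K`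
itself.** Under the named fact `Temkin2013` (Temkin 2013, Thm. 1.3.2: every valuation of a
finitely generated `K/k` is uniformized on a finite purely inseparable extension `L/K`), for
every field `k` of characteristic `p`, finitely generated `K/k` and valuation ring `O ∋ k` of
`K`, there is a finitely generated `k`-subalgebra `T ⊆ O` with `Frac T = K` such that `Spec T`
is dominated by an integral REGULAR scheme through a finite, universally injective, surjective
morphism. With Temkin's `L ⊇ K`, `O' ⊇ O`, `A ⊆ O'` regular at the centre: `B := A[1/g] ⊆ O'`
for a suitable `g` off the centre is a regular affine model of `L` (V1), and `T := B ∩ K`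
(Frobenius sandwich: finitely generated, `Frac T = K`, `Spec B → Spec T` finite radicial
surjective) lies in `O' ∩ K = O`. No field extension of `K` survives in the statement.
[cite: Temkin2013, Thm. 1.3.2] -/
theorem exists_rrModel_le_of_temkin2013 (hT : Temkin2013.{0}) (p : ℕ) [Fact p.Prime] (k K : Type)
    [Field k] [CharP k p] [Field K] [Algebra k K] (hfg : (⊤ : IntermediateField k K).FG)
    (O : ValuationSubring K) (hO : ∀ c : k, algebraMap k K c ∈ O) :
    ∃ T : Subalgebra k K, T.toSubring ≤ O.toSubring ∧ T.FG ∧ IsFractionRing T K ∧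
      ∃ (W : Scheme.{0}) (h : W ⟶ Spec (.of T)), IsIntegral W ∧ Scheme.IsRegular W ∧
        IsFinite h ∧ UniversallyInjective h ∧ Function.Surjective h.base := by
  obtain ⟨L, _, _, _, _, hfd, hpi, O', hO'O, A, hAO', hAfg, hAfr, hreg⟩ := hT k K hfg O hO
  haveI := hfd
  haveI := hpi
  haveI := hAfr
  haveI : Algebra.FiniteType k A := A.fg_iff_finiteType.mp hAfg
  -- the centre `𝔭 = 𝔪_{O'} ∩ A` lies in the regular locus of `A`
  let 𝔭 : PrimeSpectrum A :=
    ⟨Ideal.comap (Subring.inclusion hAO') (maximalIdeal O'), Ideal.comap_isPrime _ _⟩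
  have h𝔭 : 𝔭 ∈ regularLocus A := hreg
  obtain ⟨g, hg𝔭, hgreg⟩ := exists_not_mem_forall_mem_regularLocus k A 𝔭 h𝔭
  -- `g` is a unit of `O'`
  have hgO' : (g : L) ∈ O' := hAO' g.2
  have hgmax : (⟨(g : L), hgO'⟩ : O') ∉ maximalIdeal O' := hg𝔭
  have hg0 : (g : L) ≠ 0 := by
    intro h
    apply hgmax
    have : (⟨(g : L), hgO'⟩ : O') = 0 := Subtype.ext h
    rw [this]
    exact zero_mem _
  have hval : O'.valuation (g : L) = 1 := by
    have h1 : O'.valuation ((⟨(g : L), hgO'⟩ : O') : L) ≤ 1 := O'.valuation_le_one _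
    have h2 : ¬ O'.valuation ((⟨(g : L), hgO'⟩ : O') : L) < 1 := fun h =>
      hgmax ((O'.valuation_lt_one_iff _).mpr h)
    exact le_antisymm h1 (not_lt.mp h2)
  -- `B := A[1/g] ⊆ O'`, a finitely generated regular affine model of `L`
  set B : Subalgebra k L := locAway A (g : L) g.2 with hB
  have hBfg : B.FG := fg_locAway hg0 hAfg
  have hBO' : B.toSubring ≤ O'.toSubring := locAway_le_valuationSubring hAO' hval
  haveI hBfr : IsFractionRing B L := isFractionRing_of_le le_locAway hAfr
  have hBreg : Scheme.IsRegular (Spec (.of B)) := by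
    letI := (Subalgebra.inclusion
      (le_locAway (B := A) (f := (g : L)) (hf := g.2))).toRingHom.toAlgebra
    haveI : IsLocalization.Away (⟨(g : L), g.2⟩ : A) B := isLocalization_locAway hg0
    haveI : IsNoetherianRing A := Algebra.FiniteType.isNoetherianRing k A
    haveI : IsRegularRing B :=
      isRegularRing_of_isLocalization_away (C := A) (g := (⟨(g : L), g.2⟩ : A))
        (fun Q _ hQ => hgreg ⟨Q, ‹_›⟩ hQ) B
    exact Scheme.isRegular_Spec (.of B)
  -- `T := B ∩ K ⊆ O' ∩ K = O`
  refine ⟨B.comap (IsScalarTower.toAlgHom k K L), ?_, fg_comap_toAlgHom p B hBfg,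
    isFractionRing_comap_toAlgHom p B, rr_spec_comap_toAlgHom p B hBfg hBreg⟩
  intro x hx
  have hx' : algebraMap K L x ∈ O' := hBO' (show IsScalarTower.toAlgHom k K L x ∈ B from hx)
  have hx'' : x ∈ O'.comap (algebraMap K L) := hx'
  rw [hO'O] at hx''
  exact hx''

/-! ## A finite RR affine system by compactness (V4) -/

/-- **Finitely many RR affine models suffice** (Zariski's compactness theorem,
`ZariskiRiemannSpace.compactSpace`): if every valuation ring of `K` over `k` contains a finitely
generated `k`-subalgebra `T` with `Frac T = K` and `Spec T` radicially regular, then there is a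
FINITE set of such subalgebras such that every valuation ring contains one of them — the
domination loci `{w : T ⊆ 𝒪_w}` are open (`ZariskiRiemannSpace.isOpen_setOf_le`) and cover the
quasi-compact `Zar(K/k)`. (Radicial regularity of `Spec T` is a GLOBAL property of the model, so
no openness of a regular locus is needed, in contrast with `exists_finite_resolvingSystem`.)
[cite: ZariskiSamuel1960, Ch. VI §17, Thm. 40] -/
theorem exists_finite_rrSystem {k K : Type} [Field k] [Field K] [Algebra k K]
    (hLU : ∀ v : ZariskiRiemannSpace k K, ∃ T : Subalgebra k K, T.FG ∧ IsFractionRing T K ∧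
      T.toSubring ≤ v.asValuationSubring.toSubring ∧
      ∃ (W : Scheme.{0}) (h : W ⟶ Spec (.of T)), IsIntegral W ∧ Scheme.IsRegular W ∧
        IsFinite h ∧ UniversallyInjective h ∧ Function.Surjective h.base) :
    ∃ 𝒯 : Finset (Subalgebra k K),
      (∀ T ∈ 𝒯, T.FG ∧ IsFractionRing T K ∧
        ∃ (W : Scheme.{0}) (h : W ⟶ Spec (.of T)), IsIntegral W ∧ Scheme.IsRegular W ∧
          IsFinite h ∧ UniversallyInjective h ∧ Function.Surjective h.base) ∧
      ∀ w : ZariskiRiemannSpace k K, ∃ T ∈ 𝒯,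
        T.toSubring ≤ w.asValuationSubring.toSubring := by
  classical
  choose T hT using hLU
  -- the open cover `v ↦ {w : T_v ⊆ 𝒪_w} ∋ v`
  let U : ZariskiRiemannSpace k K → Set (ZariskiRiemannSpace k K) := fun v =>
    {w | (T v).toSubring ≤ w.asValuationSubring.toSubring}
  have hUo : ∀ v, IsOpen (U v) := fun v => ZariskiRiemannSpace.isOpen_setOf_le (hT v).1
  have hUmem : ∀ v, v ∈ U v := fun v => (hT v).2.2.1
  obtain ⟨t, ht⟩ := CompactSpace.elim_nhds_subcover U fun v => (hUo v).mem_nhds (hUmem v)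
  refine ⟨t.image T, ?_, fun w => ?_⟩
  · intro S hS
    obtain ⟨v, -, rfl⟩ := Finset.mem_image.mp hS
    exact ⟨(hT v).1, (hT v).2.1, (hT v).2.2.2⟩
  · have hw : w ∈ ⋃ x ∈ t, U x := by rw [ht]; trivial
    obtain ⟨x, hxt, hwx⟩ := Set.mem_iUnion₂.mp hw
    exact ⟨T x, Finset.mem_image_of_mem T hxt, hwx⟩

end Summit.ResolutionOfSingularities.ResolutionOfSingularities.Theorems.Pialt.RadiciallyRegular

end
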